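import Summits.AtomisticToContinuum.FouriersLaw.Theses.PhononMeanFreePath
import Summits.AtomisticToContinuum.FouriersLaw.Theorems.PhononMeanFreePathDefs
import Summits.AtomisticToContinuum.FouriersLaw.Theorems.PhononMeanFreePathCoherentDephasingWeakCouplingIntegrability
import Summits.AtomisticToContinuum.FouriersLaw.Theorems.PhononMeanFreePathCoherentDephasingLossComposition

/-!
# The MINIMAL sufficient conditions along line `Sketch` (crux `PhononMeanFreePath.CoherentDephasing`, stmt-AtomisticToContinuum-11810)

Two further CONDITIONAL reductions of the crux `CoherentDephasing` (`N ∫₀^∞ r_N² → 0`) over the coherent-field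
vocabulary of `Theorems/PhononMeanFreePathDefs.lean`, recorded by the line lead (c1) next to the block-loss reduction
`coherentDephasing_of_blockLossBound` (`Theorems/PhononMeanFreePathCoherentDephasingBlockLoss.lean`) so that the planner
who promotes the line's single open stub sees the whole menu of `N`-uniform inputs the landed bookkeeping consumes:

* `coherentDephasing_of_farSiteEnergy` — the WEAKEST form: if the time-integrated coherent energy AT THE FAR BATH SITE is
  `o(1/N)`, i.e. `N · E_N^{(N)} → 0` with `E_N = cohEnergy … N (Fin.last N) = ∫₀^∞ e_N(t) dt`, then the crux holds — because
  `r_N = m_N` (`momResp_last_eq_pairCorr`) and `∫₀^∞ m_N² ≤ 2 E_N` (`integral_momResp_sq_le_two_cohEnergy`, fixed `N`).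
  This is the crux restated one notch stronger (kinetic + potential coherent energy at the contact instead of the kinetic
  part alone); it is NOT a mechanism and is recorded only as the formal bottleneck every line must pass through.
* `coherentDephasing_of_weightedCoherentLifetime` — the minimal ABSOLUTE (non-relative) localisation statement: if the
  second spatial moment of the time-integrated coherent energy profile is bounded uniformly in the length,
  `∃ C, ∀ N, Σ_x (x+1)² E_x^{(N)} ≤ C` (physically `≈ 2ℓ³/v`, `ℓ` the thermal phonon mean free path; `= +∞` for the harmonic
  chain, where the coherent field spreads ballistically), then `N E_N ≤ C N/(N+1)² → 0` and the crux holds. The block loss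
  bound of skeleton v5 implies it (geometric decay of block energies beyond the head); it is implied by nothing absolute in
  the tree (the Bakry–Émery/Landauer layer bounds each `E_x` by `B`, not the weighted sum).

Both are pure real analysis on top of landed fixed-`N` facts; neither uses anharmonicity (which enters only through the
hypothesis, false at `lam = β = 0` by `HarmonicCoherentPersistence`).
-/

noncomputable section

open MeasureTheory Set Filter Topology

namespace Summit.AtomisticToContinuum.FouriersLaw.Theorems.CoherentDephasing.FarSiteEnergy

open Literature.MathematicalPhysics.KineticTheory.HeatConduction (pinnedChain PhaseSpace)
open Summit.AtomisticToContinuum.FouriersLaw.Theses.PhononMeanFreePath (CoherentDephasing)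
open Summit.AtomisticToContinuum.FouriersLaw.Theorems.PhononMeanFreePath
open Summit.AtomisticToContinuum.FouriersLaw.Theorems.CoherentDephasing.LossComposition
  (integral_momResp_sq_le_two_cohEnergy)

/-- **The crux from an `o(1/N)` coherent energy at the far contact.** If for every admissible parameter point
`N · E_N^{(N)} → 0`, where `E_N^{(N)} = cohEnergy … N (Fin.last N) = ∫₀^∞ e_N(t) dt` is the time-integrated coherent
(mean-field) energy at the far bath site of the `(N+1)`-site chain, then `CoherentDephasing` holds (by name): clause (I)
is `pairCorr_sq_integrableOn`, and `0 ≤ N ∫₀^∞ r_N² = N ∫₀^∞ m_N² ≤ 2 N E_N → 0`. [folklore] -/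
theorem coherentDephasing_of_farSiteEnergy :
    (∀ ω₂ lam β γ : ℝ, 0 < ω₂ → 0 < lam → 0 < β → 0 < γ → ∀ T : ℝ, 0 < T →
      Filter.Tendsto (fun N : ℕ => (N : ℝ) * cohEnergy ω₂ lam β γ T N (Fin.last N)) Filter.atTop (nhds 0)) →
    Summit.AtomisticToContinuum.FouriersLaw.Theses.PhononMeanFreePath.CoherentDephasing := by
  intro h ω₂ lam β γ hω hl hβ hγ T hT
  refine ⟨fun N => Summit.AtomisticToContinuum.FouriersLaw.Theorems.CoherentDephasing.pairCorr_sq_integrableOn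
    hω hl.le hβ hγ hT N, ?_⟩
  have h2E := integral_momResp_sq_le_two_cohEnergy ω₂ lam β γ hω hl hβ hγ T hT
  have hlim := (h ω₂ lam β γ hω hl hβ hγ T hT).const_mul 2
  rw [mul_zero] at hlim
  change Tendsto (fun N : ℕ => (N : ℝ) * ∫ t in Ioi (0 : ℝ), momResp ω₂ lam β γ T N (Fin.last N) t ^ 2) atTop (𝓝 0)
  refine squeeze_zero' (Eventually.of_forall fun N => mul_nonneg (Nat.cast_nonneg N)
    (setIntegral_nonneg measurableSet_Ioi fun t _ => sq_nonneg _)) (Eventually.of_forall fun N => ?_) hlim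
  calc (N : ℝ) * ∫ t in Ioi (0 : ℝ), momResp ω₂ lam β γ T N (Fin.last N) t ^ 2
      ≤ (N : ℝ) * (2 * cohEnergy ω₂ lam β γ T N (Fin.last N)) :=
        mul_le_mul_of_nonneg_left (h2E N (Fin.last N)) (Nat.cast_nonneg N)
    _ = 2 * ((N : ℝ) * cohEnergy ω₂ lam β γ T N (Fin.last N)) := by ring

/-- **The crux from an `N`-uniform second moment of the coherent energy profile** (minimal absolute localisation form
of the "finite thermal phonon mean free path"). If for every admissible parameter point there is `C` with
`Σ_{x ≤ N} (x+1)² E_x^{(N)} ≤ C` for every `N` (`E_x^{(N)} = cohEnergy … N x ≥ 0`), then `N E_N^{(N)} ≤ C·N/(N+1)² → 0` and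
`CoherentDephasing` holds by `coherentDephasing_of_farSiteEnergy`. [folklore] -/
theorem coherentDephasing_of_weightedCoherentLifetime :
    (∀ ω₂ lam β γ : ℝ, 0 < ω₂ → 0 < lam → 0 < β → 0 < γ → ∀ T : ℝ, 0 < T →
      ∃ C : ℝ, ∀ N : ℕ, ∑ x : Fin (N + 1), ((x : ℝ) + 1) ^ 2 * cohEnergy ω₂ lam β γ T N x ≤ C) →
    Summit.AtomisticToContinuum.FouriersLaw.Theses.PhononMeanFreePath.CoherentDephasing := by
  intro h
  refine coherentDephasing_of_farSiteEnergy fun ω₂ lam β γ hω hl hβ hγ T hT => ?_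
  obtain ⟨C, hC⟩ := h ω₂ lam β γ hω hl hβ hγ T hT
  have hE0 : ∀ (N : ℕ) (x : Fin (N + 1)), 0 ≤ cohEnergy ω₂ lam β γ T N x := fun N x =>
    cohEnergy_nonneg ω₂ lam β γ T N hω.le x
  -- the last term of the weighted sum: `(N+1)² E_N ≤ C`
  have hlast : ∀ N : ℕ, ((N : ℝ) + 1) ^ 2 * cohEnergy ω₂ lam β γ T N (Fin.last N) ≤ C := by
    intro N
    have hmem : Fin.last N ∈ (Finset.univ : Finset (Fin (N + 1))) := Finset.mem_univ _
    have h1 := Finset.single_le_sum (f := fun x : Fin (N + 1) => ((x : ℝ) + 1) ^ 2 * cohEnergy ω₂ lam β γ T N x)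
      (fun x _ => mul_nonneg (by positivity) (hE0 N x)) hmem
    simp only [Fin.val_last] at h1
    exact h1.trans (hC N)
  have hC0 : 0 ≤ C := le_trans (mul_nonneg (by positivity) (hE0 0 (Fin.last 0))) (hlast 0)
  -- `N E_N ≤ C · N/(N+1)² ≤ C/(N+1) → 0`
  have hlim : Tendsto (fun N : ℕ => C * (1 / ((N : ℝ) + 1))) atTop (𝓝 0) := by
    have := (tendsto_one_div_add_atTop_nhds_zero_nat).const_mul C
    rwa [mul_zero] at this
  refine squeeze_zero' (Eventually.of_forall fun N => mul_nonneg (Nat.cast_nonneg N) (hE0 N _))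
    (Eventually.of_forall fun N => ?_) hlim
  have hN1 : (0 : ℝ) < (N : ℝ) + 1 := by positivity
  have h1 : (N : ℝ) * cohEnergy ω₂ lam β γ T N (Fin.last N) ≤ ((N : ℝ) + 1) * cohEnergy ω₂ lam β γ T N (Fin.last N) :=
    mul_le_mul_of_nonneg_right (by linarith) (hE0 N _)
  have h2 : ((N : ℝ) + 1) * cohEnergy ω₂ lam β γ T N (Fin.last N) ≤ C * (1 / ((N : ℝ) + 1)) := by
    rw [mul_one_div, le_div_iff₀ hN1]
    calc ((N : ℝ) + 1) * cohEnergy ω₂ lam β γ T N (Fin.last N) * ((N : ℝ) + 1)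
        = ((N : ℝ) + 1) ^ 2 * cohEnergy ω₂ lam β γ T N (Fin.last N) := by ring
      _ ≤ C := hlast N
  exact h1.trans h2

end Summit.AtomisticToContinuum.FouriersLaw.Theorems.CoherentDephasing.FarSiteEnergy

end
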